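import Mathlib.Tactic.LinearCombination
import Summits.MatrixMultiplication.OmegaCensus.DicyclicOddCharacters
import Summits.MatrixMultiplication.OmegaCensus.NearTilingTwoCosets
import HarnessLib

/-!
# Shape `(c, c+1 | 2, 2 | 1, 1)` at `|A| ≡ 1 (mod 3)`: translate, character-sum and inversion lemmas

ω-census, family (b3).  Framing: lottery ticket; floor = certified bounds/negative ranges.

Elementary tools for `DihedralLawModOneShapeBCore.lean` (finite abelian `A`, translates written
`X.image (· + a)`): cardinalities / disjointness / character sums of translates and of pairs of translates,
orthogonality `∑_ψ ψ p ψ(−x) = |A|·[p = x]`, the resulting **two-point Fourier inversion**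
(`two_point_inversion`: if `(ψ y + ψ z)(1 − ψ u)(1 − ψ v) = 0` for all characters then the signed count of `x` among
`y, y+u, y+v, y+u+v, z, z+u, z+v, z+u+v` vanishes), the domino count `star_uncovered`
(`Q ⊔ (Q+t) ⊆ Y ⊔ (Y+t')`, `|Y| = |Q|+1` ⟹ the two uncovered points are `y₀ ∈ Y` and `y₁ + t'`, `y₁ ∈ Y`), and
`two_cosets_of_three_pieces` (a repackaging of `two_cosets_of_near_tiling_two`).
-/

namespace Summit.MatrixMultiplication.OmegaCensus

open Finset

section ShapeBLemmas

variable {A : Type*} [AddCommGroup A] [Fintype A] [DecidableEq A]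

omit [Fintype A] in
/-- Iterated translates. [folklore] -/
theorem image_add_image (X : Finset A) (a b : A) :
    (X.image (· + a)).image (· + b) = X.image (· + (a + b)) := by
  rw [image_image]; exact image_congr fun x _ => (add_assoc x a b)

omit [Fintype A] in
/-- Translation preserves cardinality. [folklore] -/
theorem card_image_add (X : Finset A) (a : A) : (X.image (· + a)).card = X.card :=
  card_image_of_injective _ (add_left_injective a)

omit [Fintype A] in
/-- Membership in a translate. [folklore] -/
theorem mem_image_add {X : Finset A} {a x : A} : x ∈ X.image (· + a) ↔ x - a ∈ X := by
  constructor
  · intro h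
    obtain ⟨y, hy, rfl⟩ := mem_image.1 h
    simpa using hy
  · intro h
    exact mem_image.2 ⟨x - a, h, sub_add_cancel x a⟩

omit [Fintype A] in
/-- Translation preserves disjointness. [folklore] -/
theorem disjoint_image_add {X Z : Finset A} (a : A) :
    Disjoint (X.image (· + a)) (Z.image (· + a)) ↔ Disjoint X Z := by
  rw [disjoint_image (add_left_injective a)]

omit [Fintype A] in
/-- A shifted copy of `Disjoint X (X + s)`. [folklore] -/
theorem disjoint_shift {X : Finset A} {s : A} (h : Disjoint X (X.image (· + s))) (a : A) :
    Disjoint (X.image (· + a)) (X.image (· + (a + s))) := by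
  have e : X.image (· + (a + s)) = (X.image (· + s)).image (· + a) := by
    rw [image_add_image, add_comm s a]
  rw [e, disjoint_image_add]
  exact h

omit [Fintype A] in
/-- Cardinality of `X ⊔ (X + a)`. [folklore] -/
theorem card_pair_union {X : Finset A} {a : A} (h : Disjoint X (X.image (· + a))) :
    (X ∪ X.image (· + a)).card = X.card + X.card := by
  rw [card_union_of_disjoint h, card_image_add]

omit [Fintype A] in
/-- Cardinality of `(X + a) ⊔ (X + b)` when disjoint. [folklore] -/
theorem card_two_translates {X : Finset A} {a b : A} (h : Disjoint (X.image (· + a)) (X.image (· + b))) :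
    (X.image (· + a) ∪ X.image (· + b)).card = X.card + X.card := by
  rw [card_union_of_disjoint h, card_image_add, card_image_add]

omit [Fintype A] [DecidableEq A] in
/-- Character sum of a translate (as a `Finset.image`). [folklore] -/
theorem charsum_image_add' [DecidableEq A] (ψ : AddChar A ℂ) (X : Finset A) (a : A) :
    ∑ x ∈ X.image (· + a), ψ x = (∑ x ∈ X, ψ x) * ψ a := by
  rw [sum_image fun x _ y _ h => add_right_cancel h, sum_mul]
  exact sum_congr rfl fun x _ => AddChar.map_add_eq_mul ψ x a

omit [Fintype A] in
/-- Character sum of `(X + a) ⊔ (X + b)`. [folklore] -/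
theorem charsum_two_translates (ψ : AddChar A ℂ) {X : Finset A} {a b : A}
    (h : Disjoint (X.image (· + a)) (X.image (· + b))) :
    ∑ x ∈ X.image (· + a) ∪ X.image (· + b), ψ x = (∑ x ∈ X, ψ x) * ψ a + (∑ x ∈ X, ψ x) * ψ b := by
  rw [sum_union h, charsum_image_add', charsum_image_add']

omit [Fintype A] in
/-- Character sum of `X ⊔ (X + a)`. [folklore] -/
theorem charsum_pair_union (ψ : AddChar A ℂ) {X : Finset A} {a : A} (h : Disjoint X (X.image (· + a))) :
    ∑ x ∈ X ∪ X.image (· + a), ψ x = (∑ x ∈ X, ψ x) + (∑ x ∈ X, ψ x) * ψ a := by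
  rw [sum_union h, charsum_image_add']

/-- Orthogonality: `∑_ψ ψ p ψ(−x) = |A| [p = x]`. [folklore] -/
theorem sum_char_mul_neg (p x : A) :
    ∑ ψ : AddChar A ℂ, ψ p * ψ (-x) = if p = x then (Fintype.card A : ℂ) else 0 := by
  have e : ∀ ψ : AddChar A ℂ, ψ p * ψ (-x) = ψ (p + -x) := fun ψ => (AddChar.map_add_eq_mul ψ p (-x)).symm
  simp_rw [e, AddChar.sum_apply_eq_ite, add_neg_eq_zero]

/-- **Fourier inversion for a two-point set against two difference operators.** If
`(ψ y + ψ z)(1 − ψ u)(1 − ψ v) = 0` for every character `ψ`, then for every `x` the signed count of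
`x` among `y, y+u, y+v, y+u+v, z, z+u, z+v, z+u+v` (signs `+ − − +`) vanishes. [folklore] -/
theorem two_point_inversion {y z u v : A}
    (h : ∀ ψ : AddChar A ℂ, (ψ y + ψ z) * ((1 - ψ u) * (1 - ψ v)) = 0) (x : A) :
    ((if y = x then (1 : ℤ) else 0) - (if y + u = x then 1 else 0) - (if y + v = x then 1 else 0)
        + (if y + u + v = x then 1 else 0))
      + ((if z = x then (1 : ℤ) else 0) - (if z + u = x then 1 else 0) - (if z + v = x then 1 else 0)
        + (if z + u + v = x then 1 else 0)) = 0 := by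
  have hsum : ∑ ψ : AddChar A ℂ, (ψ y + ψ z) * ((1 - ψ u) * (1 - ψ v)) * ψ (-x) = 0 := by
    refine sum_eq_zero fun ψ _ => ?_
    rw [h ψ, zero_mul]
  have expand : ∀ ψ : AddChar A ℂ, (ψ y + ψ z) * ((1 - ψ u) * (1 - ψ v)) * ψ (-x) =
      (ψ y * ψ (-x) - ψ (y + u) * ψ (-x) - ψ (y + v) * ψ (-x) + ψ (y + u + v) * ψ (-x))
      + (ψ z * ψ (-x) - ψ (z + u) * ψ (-x) - ψ (z + v) * ψ (-x) + ψ (z + u + v) * ψ (-x)) := by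
    intro ψ
    simp only [AddChar.map_add_eq_mul]
    ring
  simp_rw [expand] at hsum
  simp only [sum_add_distrib, sum_sub_distrib, sum_char_mul_neg] at hsum
  have hN : (Fintype.card A : ℂ) ≠ 0 := Nat.cast_ne_zero.2 Fintype.card_ne_zero
  -- every term is `|A| • indicator`; divide by `|A|`
  have key : ((Fintype.card A : ℂ)) *
      ((((if y = x then (1 : ℤ) else 0) - (if y + u = x then 1 else 0) - (if y + v = x then 1 else 0)
        + (if y + u + v = x then 1 else 0))
      + ((if z = x then (1 : ℤ) else 0) - (if z + u = x then 1 else 0) - (if z + v = x then 1 else 0)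
        + (if z + u + v = x then 1 else 0)) : ℤ) : ℂ) = 0 := by
    rw [← hsum]
    push_cast
    simp only [mul_add, mul_sub, apply_ite (fun r : ℂ => (Fintype.card A : ℂ) * r), mul_one, mul_zero]
  have := (mul_eq_zero.1 key).resolve_left hN
  exact_mod_cast this


omit [Fintype A] in
/-- **(★) bookkeeping.** If `Q ⊔ (Q+t) ⊆ Y ⊔ (Y+t')` with `Y` `t`- and `t'`-free, `Q` `t`-free and
`|Y| = |Q| + 1`, then the two uncovered points of `Y ⊔ (Y+t')` are some `y₀ ∈ Y` and some `y₁ + t'`, `y₁ ∈ Y`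
(each domino `{q, q+t}` has exactly one point in `Y` and one in `Y + t'`). [folklore] -/
theorem star_uncovered {Q Y : Finset A} {t t' : A}
    (hYt : Disjoint Y (Y.image (· + t))) (hYt' : Disjoint Y (Y.image (· + t')))
    (hQt : Disjoint Q (Q.image (· + t))) (hcard : Y.card = Q.card + 1)
    (hstar : Q ∪ Q.image (· + t) ⊆ Y ∪ Y.image (· + t')) :
    ∃ y₀ ∈ Y, ∃ y₁ ∈ Y, (Y ∪ Y.image (· + t')) \ (Q ∪ Q.image (· + t)) = {y₀, y₁ + t'} := by
  set D := Q ∪ Q.image (· + t) with hD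
  -- the map `x ↦ x` on `Q`, `x ↦ x - t` on `Q + t` sends `D ∩ Z` injectively into `Q` whenever `Z` is `t`-free
  have inj : ∀ Z : Finset A, Disjoint Z (Z.image (· + t)) → (D ∩ Z).card ≤ Q.card := by
    intro Z hZ
    refine card_le_card_of_injOn (fun x => if x ∈ Q then x else x - t) (fun x hx => ?_) ?_
    · rw [mem_coe, mem_inter] at hx
      by_cases hq : x ∈ Q
      · simp only [hq, if_true, mem_coe]
      · simp only [hq, if_false, mem_coe]
        rcases mem_union.1 hx.1 with h | h
        · exact absurd h hq
        · exact mem_image_add.1 h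
    · intro x hx x' hx' he
      rw [mem_coe, mem_inter] at hx hx'
      by_cases hq : x ∈ Q <;> by_cases hq' : x' ∈ Q
      · simpa [hq, hq'] using he
      · simp only [hq, hq', if_true, if_false] at he
        -- `x = x' - t`, so `x' = x + t` : both in `Z`
        exfalso
        have hx't : x' ∈ Z.image (· + t) := mem_image.2 ⟨x, hx.2, by rw [he, sub_add_cancel]⟩
        exact disjoint_left.1 hZ hx'.2 hx't
      · simp only [hq, hq', if_true, if_false] at he
        exfalso
        have hxt : x ∈ Z.image (· + t) := mem_image.2 ⟨x', hx'.2, by rw [← he, sub_add_cancel]⟩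
        exact disjoint_left.1 hZ hx.2 hxt
      · simp only [hq, hq', if_false] at he
        exact sub_left_injective he
  have hDM : D ⊆ Y ∪ Y.image (· + t') := hstar
  have cD : D.card = Q.card + Q.card := card_pair_union hQt
  -- `Y + t'` is `t`-free as well
  have hYt't : Disjoint (Y.image (· + t')) ((Y.image (· + t')).image (· + t)) := by
    rw [image_add_image, add_comm t' t, ← image_add_image, disjoint_image_add]; exact hYt
  have c1 := inj Y hYt
  have c2 := inj (Y.image (· + t')) hYt't
  have csplit : D.card = (D ∩ Y).card + (D ∩ Y.image (· + t')).card := by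
    rw [← card_union_of_disjoint (disjoint_of_subset_left inter_subset_right
      (disjoint_of_subset_right inter_subset_right hYt')), ← inter_union_distrib_left,
      inter_eq_left.2 hDM]
  have e1 : (D ∩ Y).card = Q.card := by omega
  have e2 : (D ∩ Y.image (· + t')).card = Q.card := by omega
  have r1 : (Y \ D).card = 1 := by
    have h := card_sdiff_add_card_inter Y D
    rw [inter_comm, e1, hcard] at h; omega
  have r2 : (Y.image (· + t') \ D).card = 1 := by
    have h := card_sdiff_add_card_inter (Y.image (· + t')) D
    rw [inter_comm, e2, card_image_add, hcard] at h; omega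
  obtain ⟨y₀, hy₀⟩ := card_eq_one.1 r1
  obtain ⟨z₀, hz₀⟩ := card_eq_one.1 r2
  have hy₀Y : y₀ ∈ Y := (mem_sdiff.1 (by rw [hy₀]; exact mem_singleton_self y₀)).1
  have hz₀Y : z₀ ∈ Y.image (· + t') := (mem_sdiff.1 (by rw [hz₀]; exact mem_singleton_self z₀)).1
  obtain ⟨y₁, hy₁, rfl⟩ := mem_image.1 hz₀Y
  refine ⟨y₀, hy₀Y, y₁, hy₁, ?_⟩
  rw [union_sdiff_distrib, hy₀, hz₀]
  rfl

/-- Three pieces `P`, `P + e`, `C` tiling `A` with `|P| = |C| + 2` and `C ⊆ P + 2e`: at most two cosets of `⟨e⟩`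
(repackaging of `two_cosets_of_near_tiling_two`). [folklore] -/
theorem two_cosets_of_three_pieces {P C : Finset A} {e : A}
    (hPC : Disjoint P C) (hPe : Disjoint P (P.image (· + e))) (hPeC : Disjoint (P.image (· + e)) C)
    (hcardA : P.card + P.card + C.card = Fintype.card A) (hcard : P.card = C.card + 2)
    (hCsub : C ⊆ P.image (· + (e + e))) :
    ∃ a b : A, ∀ x : A, x - a ∈ AddSubgroup.zmultiples e ∨ x - b ∈ AddSubgroup.zmultiples e := by
  have hcov : P ∪ P.image (· + e) ∪ C = univ := by
    apply eq_univ_of_card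
    rw [card_union_of_disjoint (disjoint_union_left.2 ⟨hPC, hPeC⟩), card_union_of_disjoint hPe,
      card_image_add, hcardA]
  have hCC : Disjoint C (C.image (· + e)) := by
    have h1 : Disjoint (P.image (· + (e + e))) (P.image (· + (e + e + e))) := disjoint_shift hPe (e + e)
    refine disjoint_of_subset_left hCsub (disjoint_of_subset_right ?_ h1)
    intro x hx
    obtain ⟨c, hc, rfl⟩ := mem_image.1 hx
    obtain ⟨p, hp, rfl⟩ := mem_image.1 (hCsub hc)
    exact mem_image.2 ⟨p, hp, (add_assoc p (e + e) e).symm⟩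
  exact two_cosets_of_near_tiling_two hPC hPeC hcov hCC hcard hPe


omit [Fintype A] [DecidableEq A] in
/-- `ψ a · ψ (−a) = 1`. [folklore] -/
theorem addChar_mul_neg (ψ : AddChar A ℂ) (a : A) : ψ a * ψ (-a) = 1 := by
  rw [← AddChar.map_add_eq_mul, add_neg_cancel, AddChar.map_zero_eq_one]


end ShapeBLemmas

end Summit.MatrixMultiplication.OmegaCensus
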